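import Mathlib
import Literature.Computability.AlgebraicComplexity.DeterminantalConormalBound

/-!
# Crux `DetQP.DetqpSuperquadratic` (stmt-ValiantsHypothesis-0318), line `sectional-class-ladder` —
# stub `stub_bezoutGrowth`: the growth lemma for Sheshadri's two-kernel Bézout number

The purely arithmetic step of the line.  If at a rung `k ≥ n^{1+ε}` Sheshadri's two-kernel Bézout
number `B(m, k+2) = conormalBezout m (k+2) = Σ_{i=1}^{k+1} C(m,i) C(m-1,k+1-i) C(k,i-1)` is at
least `n^{(1-θ)k}` (`0 < θ < ε`), then `m ≥ n^{2+(ε-θ)/2}` for all `n ≥ n₁(ε, θ)`.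

Proof.  Termwise `C(k, i-1) ≤ 2^k` and Vandermonde (`Nat.add_choose_eq`) give
`B(m, k+2) ≤ 2^k · C(2m, k+1)`, hence `B(m, k+2) · (k+1)! ≤ 2^k · (2m)^{k+1}`
(`C(2m, k+1) · (k+1)!` is a descending factorial), and `(k+1)^{k+1} ≤ e^{k+1} · (k+1)!`
(`Real.pow_div_factorial_le_exp`) yields the real estimate
`B(m, k+2) · (k+1)^{k+1} ≤ 2^k · (2e·m)^{k+1}`.
Put `δ = (ε-θ)/2`, `a = n^{1-θ}`, `b = n^{1+ε} ≤ k < k+1`, `c = n^{2+δ}`, `d = n^δ`; then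
`c·d = a·b`, `c ≤ n·b`, and the hypothesis reads `a^k ≤ B(m, k+2)`, so
`a^k · b^{k+1} ≤ 2^k (2e)^{k+1} · m^{k+1}`.  On the other hand, as soon as `n ≥ 3` and `n^δ ≥ 16e`,
`2e · n · (4e)^k ≤ 8n · (4e)^k ≤ 4^k (4e)^k = (16e)^k ≤ d^k` (using `n ≤ 2^n ≤ 2^k`, `8 ≤ 2^k`), whence
`2^k (2e)^{k+1} · c^{k+1} = (2e (4e)^k c) · c^k ≤ d^k b c^k = (cd)^k b = a^k b^{k+1}`.  Together,
`c^{k+1} ≤ m^{k+1}`, i.e. `c ≤ m`.  The threshold `n₁` exists because `x ↦ x^δ → ∞`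
(`tendsto_rpow_atTop`).
-/

noncomputable section

-- `Summit.ValiantsHypothesis.ValiantsHypothesis.…` is the tree's mandated single-conjunct layout
-- (Sub = Summit), so the duplicated namespace component is intended.
set_option linter.dupNamespace false

namespace Summit.ValiantsHypothesis.ValiantsHypothesis.Theorems.DetQPDetqpSuperquadratic

open Finset Filter
open Literature.Computability.AlgebraicComplexity

namespace BezoutGrowth

/-- Vandermonde-type bound `B(m, k+2) ≤ 2^k · C(2m, k+1)`: bound `C(k, i-1) ≤ 2^k` termwise, enlarge
the range `1 ≤ i ≤ k+1` to `0 ≤ i ≤ k+1`, apply Vandermonde and `C(2m-1, ·) ≤ C(2m, ·)`. [folklore] -/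
theorem conormalBezout_le_two_pow_mul_choose (m k : ℕ) :
    conormalBezout m (k + 2) ≤ 2 ^ k * (2 * m).choose (k + 1) := by
  have h0 : conormalBezout m (k + 2) =
      ∑ i ∈ Icc 1 (k + 1), m.choose i * (m - 1).choose (k + 1 - i) * k.choose (i - 1) := rfl
  have h1 : ∑ i ∈ Icc 1 (k + 1), m.choose i * (m - 1).choose (k + 1 - i) * k.choose (i - 1) ≤
      ∑ i ∈ Icc 1 (k + 1), m.choose i * (m - 1).choose (k + 1 - i) * 2 ^ k :=
    Finset.sum_le_sum fun i _ => Nat.mul_le_mul_left _ (Nat.choose_le_two_pow k (i - 1))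
  have h2 : ∑ i ∈ Icc 1 (k + 1), m.choose i * (m - 1).choose (k + 1 - i) * 2 ^ k ≤
      ∑ i ∈ range (k + 2), m.choose i * (m - 1).choose (k + 1 - i) * 2 ^ k :=
    Finset.sum_le_sum_of_subset fun i hi => by
      rw [Finset.mem_Icc] at hi
      exact Finset.mem_range.2 (by omega)
  have h3 : ∑ i ∈ range (k + 2), m.choose i * (m - 1).choose (k + 1 - i) =
      (m + (m - 1)).choose (k + 1) := by
    rw [Nat.add_choose_eq, Finset.Nat.sum_antidiagonal_eq_sum_range_succ_mk]
  have h4 : (m + (m - 1)).choose (k + 1) ≤ (2 * m).choose (k + 1) :=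
    Nat.choose_le_choose _ (by omega)
  calc conormalBezout m (k + 2)
      = ∑ i ∈ Icc 1 (k + 1), m.choose i * (m - 1).choose (k + 1 - i) * k.choose (i - 1) := h0
    _ ≤ ∑ i ∈ Icc 1 (k + 1), m.choose i * (m - 1).choose (k + 1 - i) * 2 ^ k := h1
    _ ≤ ∑ i ∈ range (k + 2), m.choose i * (m - 1).choose (k + 1 - i) * 2 ^ k := h2
    _ = 2 ^ k * ∑ i ∈ range (k + 2), m.choose i * (m - 1).choose (k + 1 - i) := by
      rw [Finset.mul_sum]
      exact Finset.sum_congr rfl fun i _ => by ring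
    _ ≤ 2 ^ k * (2 * m).choose (k + 1) := by
      rw [h3]
      exact Nat.mul_le_mul_left _ h4

/-- `B(m, k+2) · (k+1)! ≤ 2^k · (2m)^{k+1}`, since `C(2m, k+1) · (k+1)!` is the descending
factorial `(2m)(2m-1)⋯(2m-k) ≤ (2m)^{k+1}`. [folklore] -/
theorem conormalBezout_mul_factorial_le (m k : ℕ) :
    conormalBezout m (k + 2) * (k + 1).factorial ≤ 2 ^ k * (2 * m) ^ (k + 1) := by
  have h1 := conormalBezout_le_two_pow_mul_choose m k
  have h2 : (2 * m).choose (k + 1) * (k + 1).factorial ≤ (2 * m) ^ (k + 1) := by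
    rw [mul_comm, ← Nat.descFactorial_eq_factorial_mul_choose]
    exact Nat.descFactorial_le_pow _ _
  calc conormalBezout m (k + 2) * (k + 1).factorial
      ≤ 2 ^ k * (2 * m).choose (k + 1) * (k + 1).factorial := Nat.mul_le_mul_right _ h1
    _ = 2 ^ k * ((2 * m).choose (k + 1) * (k + 1).factorial) := by ring
    _ ≤ 2 ^ k * (2 * m) ^ (k + 1) := Nat.mul_le_mul_left _ h2

/-- The factorial versus the exponential: `(k+1)^{k+1} ≤ e^{k+1} · (k+1)!`
(from `x^n / n! ≤ exp x` at `x = n = k + 1`). [folklore] -/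
theorem pow_self_le_exp_pow_mul_factorial (k : ℕ) :
    ((k : ℝ) + 1) ^ (k + 1) ≤ Real.exp 1 ^ (k + 1) * ((k + 1).factorial : ℝ) := by
  have h := Real.pow_div_factorial_le_exp (x := (k : ℝ) + 1) (by positivity) (k + 1)
  rw [div_le_iff₀ (by positivity)] at h
  calc ((k : ℝ) + 1) ^ (k + 1) ≤ Real.exp ((k : ℝ) + 1) * ((k + 1).factorial : ℝ) := h
    _ = Real.exp 1 ^ (k + 1) * ((k + 1).factorial : ℝ) := by
      rw [Real.exp_one_pow]
      push_cast
      ring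

/-- The real growth estimate for Sheshadri's number:
`B(m, k+2) · (k+1)^{k+1} ≤ 2^k · (2e·m)^{k+1}`, i.e. `B(m, k+2) ≤ ½ (4em/(k+1))^{k+1}`. [folklore] -/
theorem conormalBezout_mul_pow_le (m k : ℕ) :
    (conormalBezout m (k + 2) : ℝ) * ((k : ℝ) + 1) ^ (k + 1) ≤
      2 ^ k * (2 * Real.exp 1 * m) ^ (k + 1) := by
  have h1 : (conormalBezout m (k + 2) : ℝ) * ((k + 1).factorial : ℝ) ≤ 2 ^ k * (2 * m) ^ (k + 1) := by
    exact_mod_cast conormalBezout_mul_factorial_le m k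
  have h2 := pow_self_le_exp_pow_mul_factorial k
  have hB : (0 : ℝ) ≤ conormalBezout m (k + 2) := Nat.cast_nonneg _
  calc (conormalBezout m (k + 2) : ℝ) * ((k : ℝ) + 1) ^ (k + 1)
      ≤ (conormalBezout m (k + 2) : ℝ) * (Real.exp 1 ^ (k + 1) * ((k + 1).factorial : ℝ)) :=
        mul_le_mul_of_nonneg_left h2 hB
    _ = Real.exp 1 ^ (k + 1) * ((conormalBezout m (k + 2) : ℝ) * ((k + 1).factorial : ℝ)) := by
        ring
    _ ≤ Real.exp 1 ^ (k + 1) * (2 ^ k * (2 * m) ^ (k + 1)) :=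
        mul_le_mul_of_nonneg_left h1 (by positivity)
    _ = 2 ^ k * (2 * Real.exp 1 * m) ^ (k + 1) := by ring

end BezoutGrowth

open BezoutGrowth in
/-- **Registered sub-goal `stub_bezoutGrowth` — the growth lemma for Sheshadri's number.**  For
`0 < θ < ε` there is `n₁` such that for all `n ≥ n₁` and all `k, m`: if `k ≥ n^{1+ε}` and
`B(m, k+2) = conormalBezout m (k+2) ≥ n^{(1-θ)k}`, then `m ≥ n^{2+(ε-θ)/2}`.  Proof in the module
docstring: `B(m, k+2) · (k+1)^{k+1} ≤ 2^k (2e·m)^{k+1}` (`BezoutGrowth.conormalBezout_mul_pow_le`) and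
exponent bookkeeping with `n^{(ε-θ)/2} ≥ 16e`, `n ≥ 3`. [folklore] -/
theorem stub_bezoutGrowth (ε θ : ℝ) (hθ : 0 < θ) (hθε : θ < ε) :
    ∃ n₁ : ℕ, ∀ n ≥ n₁, ∀ k m : ℕ, (n : ℝ) ^ (1 + ε) ≤ (k : ℝ) →
      (n : ℝ) ^ ((1 - θ) * (k : ℝ)) ≤ (conormalBezout m (k + 2) : ℝ) →
        (n : ℝ) ^ (2 + (ε - θ) / 2) ≤ (m : ℝ) := by
  set δ : ℝ := (ε - θ) / 2 with hδ_def
  have hδ : 0 < δ := by rw [hδ_def]; linarith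
  have hδε : δ ≤ ε := by rw [hδ_def]; linarith
  -- the threshold `n₁`: `n ≥ 3` and `n^δ ≥ 16e`
  have hev : ∀ᶠ n : ℕ in atTop, 3 ≤ n ∧ 16 * Real.exp 1 ≤ (n : ℝ) ^ δ := by
    refine (eventually_ge_atTop 3).and ?_
    exact ((tendsto_rpow_atTop hδ).comp tendsto_natCast_atTop_atTop).eventually_ge_atTop _
  obtain ⟨n₁, hn₁⟩ := eventually_atTop.1 hev
  refine ⟨n₁, fun n hn k m hk hB => ?_⟩
  obtain ⟨hn3, hd⟩ := hn₁ n hn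
  have hN1 : (1 : ℝ) ≤ (n : ℝ) := by exact_mod_cast (show 1 ≤ n by omega)
  have hN0 : (0 : ℝ) < (n : ℝ) := by linarith
  -- the four powers of `n`
  set a : ℝ := (n : ℝ) ^ (1 - θ) with ha_def
  set b : ℝ := (n : ℝ) ^ (1 + ε) with hb_def
  set c : ℝ := (n : ℝ) ^ (2 + δ) with hc_def
  set d : ℝ := (n : ℝ) ^ δ with hd_def
  have ha0 : 0 < a := Real.rpow_pos_of_pos hN0 _
  have hb0 : 0 < b := Real.rpow_pos_of_pos hN0 _
  have hc0 : 0 < c := Real.rpow_pos_of_pos hN0 _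
  have hcd : c * d = a * b := by
    rw [ha_def, hb_def, hc_def, hd_def, ← Real.rpow_add hN0, ← Real.rpow_add hN0]
    congr 1
    rw [hδ_def]
    ring
  have hNb : (n : ℝ) ≤ b := by
    rw [hb_def]
    conv_lhs => rw [← Real.rpow_one (n : ℝ)]
    exact Real.rpow_le_rpow_of_exponent_le hN1 (by linarith)
  have hcNb : c ≤ (n : ℝ) * b := by
    have : (n : ℝ) * b = (n : ℝ) ^ (2 + ε) := by
      rw [hb_def, show (2 : ℝ) + ε = 1 + (1 + ε) by ring, Real.rpow_add hN0 1 (1 + ε),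
        Real.rpow_one]
    rw [this, hc_def]
    exact Real.rpow_le_rpow_of_exponent_le hN1 (by linarith)
  -- the hypotheses in terms of `a`, `b`
  have hak : a ^ k ≤ (conormalBezout m (k + 2) : ℝ) := by
    rw [ha_def, ← Real.rpow_natCast, ← Real.rpow_mul hN0.le]
    exact hB
  have hnk : n ≤ k := by
    have : (n : ℝ) ≤ (k : ℝ) := hNb.trans hk
    exact_mod_cast this
  have h3k : 3 ≤ k := hn3.trans hnk
  have hbK : b ^ (k + 1) ≤ ((k : ℝ) + 1) ^ (k + 1) :=
    pow_le_pow_left₀ hb0.le (hk.trans (by linarith)) _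
  -- upper estimate: `a^k b^{k+1} ≤ 2^k (2em)^{k+1}`
  have h1 : a ^ k * b ^ (k + 1) ≤ 2 ^ k * (2 * Real.exp 1 * m) ^ (k + 1) :=
    calc a ^ k * b ^ (k + 1) ≤ (conormalBezout m (k + 2) : ℝ) * ((k : ℝ) + 1) ^ (k + 1) :=
          mul_le_mul hak hbK (by positivity) (by positivity)
      _ ≤ 2 ^ k * (2 * Real.exp 1 * m) ^ (k + 1) := conormalBezout_mul_pow_le m k
  -- lower estimate: `2^k (2e)^{k+1} c^{k+1} ≤ a^k b^{k+1}`
  have he3 : Real.exp 1 < 3 := Real.exp_one_lt_three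
  have he0 : 0 < Real.exp 1 := Real.exp_pos 1
  have h4k : (4 : ℝ) ^ k = 2 ^ k * 2 ^ k := by
    rw [← mul_pow]
    norm_num
  have h2k : (n : ℝ) ≤ 2 ^ k := by
    have : n ≤ 2 ^ k := (Nat.lt_two_pow_self).le.trans (Nat.pow_le_pow_right (by norm_num) hnk)
    exact_mod_cast this
  have h8 : (8 : ℝ) ≤ 2 ^ k := by
    have : (2 : ℝ) ^ 3 ≤ 2 ^ k := pow_le_pow_right₀ (by norm_num) h3k
    linarith [show (2 : ℝ) ^ 3 = 8 by norm_num]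
  have h2eN : 2 * Real.exp 1 * (n : ℝ) ≤ 4 ^ k := by
    rw [h4k]
    calc 2 * Real.exp 1 * (n : ℝ) ≤ 8 * (n : ℝ) := by nlinarith
      _ ≤ 2 ^ k * 2 ^ k := mul_le_mul h8 h2k hN0.le (by positivity)
  have hd16 : 4 * (4 * Real.exp 1) ≤ d := by linarith
  have hdk : (4 * (4 * Real.exp 1)) ^ k ≤ d ^ k := pow_le_pow_left₀ (by positivity) hd16 k
  have h2 : 2 * Real.exp 1 * (4 * Real.exp 1) ^ k * c ≤ d ^ k * b :=
    calc 2 * Real.exp 1 * (4 * Real.exp 1) ^ k * c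
        ≤ 2 * Real.exp 1 * (4 * Real.exp 1) ^ k * ((n : ℝ) * b) :=
          mul_le_mul_of_nonneg_left hcNb (by positivity)
      _ = (2 * Real.exp 1 * (n : ℝ)) * (4 * Real.exp 1) ^ k * b := by ring
      _ ≤ 4 ^ k * (4 * Real.exp 1) ^ k * b :=
          mul_le_mul_of_nonneg_right (mul_le_mul_of_nonneg_right h2eN (by positivity)) hb0.le
      _ = (4 * (4 * Real.exp 1)) ^ k * b := by rw [mul_pow (4 : ℝ) (4 * Real.exp 1) k]
      _ ≤ d ^ k * b := mul_le_mul_of_nonneg_right hdk hb0.le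
  have h3 : 2 ^ k * (2 * Real.exp 1) ^ (k + 1) * c ^ (k + 1) ≤ a ^ k * b ^ (k + 1) :=
    calc 2 ^ k * (2 * Real.exp 1) ^ (k + 1) * c ^ (k + 1)
        = (2 * Real.exp 1 * (4 * Real.exp 1) ^ k * c) * c ^ k := by
          rw [mul_pow (4 : ℝ) (Real.exp 1) k, h4k]
          ring
      _ ≤ (d ^ k * b) * c ^ k := mul_le_mul_of_nonneg_right h2 (by positivity)
      _ = (c * d) ^ k * b := by rw [mul_pow]; ring
      _ = a ^ k * b ^ (k + 1) := by rw [hcd, mul_pow, pow_succ]; ring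
  -- conclusion: `c^{k+1} ≤ m^{k+1}`
  have h4 : (2 ^ k * (2 * Real.exp 1) ^ (k + 1)) * c ^ (k + 1) ≤
      (2 ^ k * (2 * Real.exp 1) ^ (k + 1)) * (m : ℝ) ^ (k + 1) :=
    calc (2 ^ k * (2 * Real.exp 1) ^ (k + 1)) * c ^ (k + 1) ≤ a ^ k * b ^ (k + 1) := h3
      _ ≤ 2 ^ k * (2 * Real.exp 1 * m) ^ (k + 1) := h1
      _ = (2 ^ k * (2 * Real.exp 1) ^ (k + 1)) * (m : ℝ) ^ (k + 1) := by rw [mul_pow]; ring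
  have h5 : c ^ (k + 1) ≤ (m : ℝ) ^ (k + 1) := le_of_mul_le_mul_left h4 (by positivity)
  exact le_of_pow_le_pow_left₀ (Nat.succ_ne_zero k) (Nat.cast_nonneg m) h5

end Summit.ValiantsHypothesis.ValiantsHypothesis.Theorems.DetQPDetqpSuperquadratic
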